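import Summits.ResolutionOfSingularities.ResolutionOfSingularities.Theorems.ValuativeLuAlphaPTorsorTowerStep
import Summits.ResolutionOfSingularities.ResolutionOfSingularities.Theorems.ValuativeLuAlphaPTorsorChartRegular
import Summits.ResolutionOfSingularities.ResolutionOfSingularities.Theorems.ValuativeLuAlphaPTorsorFrobeniusTwistSeparable
import Summits.ResolutionOfSingularities.ResolutionOfSingularities.Theorems.ValuativeLuAlphaPTorsorAbhyankarTransfer
import Literature.AlgebraicGeometry.Resolution.NormalizationFractions
import HarnessLib

/-!
# `LuAlphaPTorsor` along zero-dimensional RANK-ONE Abhyankar places, modulo the chart stubs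

Crux `Valuative.LuAlphaPTorsor` (item `stmt-ResolutionOfSingularities-0641`), line
`pfaff-line-log-final-forms`, reshape v6 (lead seat c4), assembly S6: the tower induction, the
absorption of `A₀ ∪ {t}`, and the conclusion of the crux — from the LANDED S1
(`stub_frobeniusTwistSeparable`), the regularity of very good charts
(`isRegularLocalRing_of_chart`) and the step (`exists_chart_adjoin_of_pow_mem`), MODULO the
registered stubs S2 (`stub_henselRootChart`), S3 (`stub_perronMonomialization`), S4
(`stub_valueStep`), S5 (`stub_residueStep`), taken as hypotheses by their verbatim statements.

* `isAbhyankarPlace_adjoin_range_pow` — the place stays Abhyankar on `K_e = k(K^{p^e})`.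
* `exists_chart_adjoin_finset` — charts climb finitely many `α_p`-steps.
* `exists_chart_top` — a very good chart of `K` itself (Frobenius twist + tower).
* `exists_chart_absorbing` — absorbing finitely many elements of `O` into a chart (S3 twice).
* `rankOneAbhyankar_of_stubs` — the registered statement of `stub_rankOneAbhyankar`, modulo
  S2–S5.
-/

set_option linter.dupNamespace false

open IsLocalRing

namespace Summit.ResolutionOfSingularities.ResolutionOfSingularities.Theorems.PfaffLine

open Literature.AlgebraicGeometry.Resolution

variable {k K : Type} [Field k] [Field K] [Algebra k K]

/-! ### The place stays Abhyankar on `K_e` -/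

/-- **`K` is algebraic over `K_e = k(K^{p^e})`** (`p ≠ 0`): `z` is a root of `X^{p^e} − z^{p^e}`.
[folklore] -/
theorem isAlgebraic_adjoin_range_pow {p : ℕ} (hp : 0 < p) (e : ℕ) (z : K) :
    IsAlgebraic (IntermediateField.adjoin k (Set.range fun z : K => z ^ p ^ e)) z := by
  set M := IntermediateField.adjoin k (Set.range fun z : K => z ^ p ^ e)
  have hz : z ^ p ^ e ∈ M := IntermediateField.subset_adjoin k _ ⟨z, rfl⟩
  exact IsAlgebraic.of_pow (pow_pos hp e) (isAlgebraic_algebraMap (⟨z ^ p ^ e, hz⟩ : M))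

/-- **An Abhyankar place of `K/k` restricts to an Abhyankar place of `K_e = k(K^{p^e})`**
(`p ≠ 0`): the `p^e`-th powers of Abhyankar data of `K/k` lie in `K_e`, keep `ℤ`-independent
values and algebraically independent residues, and `K ⊇ K_e` is algebraic over the field they
generate (same proof as the landed `stub_abhyankarTransfer`, with `p^e` for `p`). [folklore] -/
theorem isAbhyankarPlace_adjoin_range_pow {p : ℕ} (hp : 0 < p) (e : ℕ) (O : ValuationSubring K)
    (hA : IsAbhyankarPlace O (algebraMap k K).fieldRange ⊤) :
    IsAbhyankarPlace O (algebraMap k K).fieldRange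
      (IntermediateField.adjoin k (Set.range fun z : K => z ^ p ^ e)).toSubfield := by
  classical
  set q : ℕ := p ^ e with hq
  have hq0 : 0 < q := pow_pos hp e
  set kK : Subfield K := (algebraMap k K).fieldRange with hkK
  set Ke : IntermediateField k K := IntermediateField.adjoin k (Set.range fun z : K => z ^ q)
    with hKe
  have hKp : ∀ z : K, z ^ q ∈ Ke.toSubfield := fun z =>
    IntermediateField.subset_adjoin k _ ⟨z, rfl⟩
  obtain ⟨ρ, τ, x, y, hy, -, -, hvi, hri, halg⟩ := hA
  have hy' : ∀ j, y j ^ q ∈ O := fun j => O.pow_mem (hy j) q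
  have hvi' := abhTransfer_valIndep_pow O kK x hq0.ne' hvi
  have hri' := abhTransfer_algIndep_residue_pow O (resField O kK) y hy hq0 hy' hri
  refine isAbhyankarPlace_of_algebraic (V := O) (K := kK) (x := fun i => x i ^ q)
    (y := fun j => y j ^ q) hy' hvi' hri' ?_ ?_
  · refine Subfield.closure_le.mpr ?_
    rintro z (hz | ⟨i, rfl⟩ | ⟨j, rfl⟩)
    · obtain ⟨c, rfl⟩ := RingHom.mem_fieldRange.mp hz
      exact Ke.algebraMap_mem c
    · exact hKp _
    · exact hKp _
  · intro z _
    have hz : IsAlgebraic (Subfield.closure ((kK : Set K) ∪ (Set.range x ∪ Set.range y))) z :=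
      (isAlgebraic_closure_iff kK _ z).mpr (halg z (Subfield.mem_top z))
    refine isAlgebraic_trans_subfield (Subfield.closure_le.mpr ?_)
      (fun w hw => abhTransfer_isAlgebraic_closure_pow kK x y hq0 hw) hz
    have hxF : ∀ i, x i ∈ Subfield.closure ((kK : Set K) ∪ (Set.range x ∪ Set.range y)) :=
      fun i => Subfield.subset_closure (Or.inr (Or.inl ⟨i, rfl⟩))
    have hyF : ∀ j, y j ∈ Subfield.closure ((kK : Set K) ∪ (Set.range x ∪ Set.range y)) :=
      fun j => Subfield.subset_closure (Or.inr (Or.inr ⟨j, rfl⟩))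
    rintro w (hw | ⟨i, rfl⟩ | ⟨j, rfl⟩)
    · exact Subfield.subset_closure (Or.inl hw)
    · exact Subfield.pow_mem _ (hxF i) q
    · exact Subfield.pow_mem _ (hyF j) q

section Stubs

/-! ### The stubs as hypotheses (verbatim registered statements) -/

variable
  (hS2 : ∀ p : ℕ, p.Prime → ∀ (k K : Type) [Field k] [CharP k p] [Field K] [Algebra k K] (O : ValuationSubring K), (∀ c : k, algebraMap k K c ∈ O) → (⊤ : IntermediateField k K).FG → (∀ x : K, x ∈ O → ∃ f : Polynomial k, f ≠ 0 ∧ Polynomial.aeval x f ∈ O.nonunits) → ∀ (M : IntermediateField k K), M.FG → Literature.AlgebraicGeometry.Resolution.IsAbhyankarPlace O (algebraMap k K).fieldRange M.toSubfield → Literature.AlgebraicGeometry.Resolution.SeparablyGeneratedOver (Literature.AlgebraicGeometry.Resolution.resField O (algebraMap k K).fieldRange) (Literature.AlgebraicGeometry.Resolution.resField O M.toSubfield) → (∀ z : K, IsAlgebraic M z) → ∃ (n : ℕ) (R : Subalgebra k K) (hRO : R.toSubring ≤ O.toSubring) (x : Fin n → K) (hx : ∀ i, x i ∈ R), R.FG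 ∧ R ≤ M.toSubalgebra ∧ ((M : Set K) ⊆ Subfield.closure (R : Set K)) ∧ (∀ i, x i ≠ 0) ∧ Ideal.span (Set.range fun i => (⟨x i, hx i⟩ : R.toSubring)) = Ideal.comap (Subring.inclusion hRO) (IsLocalRing.maximalIdeal O) ∧ (∀ m : Fin n → ℤ, (∏ i, O.valuation (x i) ^ (m i)) = 1 → m = 0) ∧ IsTranscendenceBasis k x)
  (hS3 : ∀ (k K : Type) [Field k] [Field K] [Algebra k K] (O : ValuationSubring K) (n : ℕ) (R : Subalgebra k K) (hRO : R.toSubring ≤ O.toSubring) (x : Fin n → K) (hx : ∀ i, x i ∈ R), R.FG → (∀ i, x i ≠ 0) → Ideal.span (Set.range fun i => (⟨x i, hx i⟩ : R.toSubring)) = Ideal.comap (Subring.inclusion hRO) (IsLocalRing.maximalIdeal O) → (∀ m : Fin n → ℤ, (∏ i, O.valuation (x i) ^ (m i)) = 1 → m = 0) → (∀ z w : K, O.valuation z < 1 → w ≠ 0 → ∃ N : ℕ, O.valuation z ^ N < O.valuation w) → ∀ (m : ℕ) (a : Fin m → K), (∀ j, a j ∈ R ∧ a j ≠ 0) → ∀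 (l : ℕ) (h : Fin l → Fin n → ℤ), (∀ j, (∏ i, O.valuation (x i) ^ (h j i)) ≤ 1) → ∃ (R' : Subalgebra k K) (hR'O : R'.toSubring ≤ O.toSubring) (x' : Fin n → K) (hx' : ∀ i, x' i ∈ R'), R ≤ R' ∧ R'.FG ∧ ((R' : Set K) ⊆ Subfield.closure (R : Set K)) ∧ (∀ i, x' i ≠ 0) ∧ Ideal.span (Set.range fun i => (⟨x' i, hx' i⟩ : R'.toSubring)) = Ideal.comap (Subring.inclusion hR'O) (IsLocalRing.maximalIdeal O) ∧ (∀ m : Fin n → ℤ, (∏ i, O.valuation (x' i) ^ (m i)) = 1 → m = 0) ∧ (∀ i, ∃ d : Fin n → ℕ, x i = ∏ j, x' j ^ (d j)) ∧ (∀ j, ∃ (α : Fin n → ℕ) (u : K), u ∈ R' ∧ O.valuation u = 1 ∧ a j = (∏ i, x' i ^ (α i)) * u) ∧ (∀ j, ∃ e : Fin n → ℕ, (∏ i, x i ^ (h j i)) = ∏ i, x' i ^ (e i)))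
  (hS4 : ∀ p : ℕ, p.Prime → ∀ (k K : Type) [Field k] [Field K] [Algebra k K] (O : ValuationSubring K) (n : ℕ) (R : Subalgebra k K) (hRO : R.toSubring ≤ O.toSubring) (x : Fin n → K) (hx : ∀ i, x i ∈ R), R.FG → (∀ i, x i ≠ 0) → Ideal.span (Set.range fun i => (⟨x i, hx i⟩ : R.toSubring)) = Ideal.comap (Subring.inclusion hRO) (IsLocalRing.maximalIdeal O) → (∀ m : Fin n → ℤ, (∏ i, O.valuation (x i) ^ (m i)) = 1 → m = 0) → ∀ (t u : K) (α : Fin n → ℕ), u ∈ R → u⁻¹ ∈ R → O.valuation u = 1 → t ^ p = (∏ i, x i ^ (α i)) * u → (∀ m : Fin n → ℤ, O.valuation t ≠ ∏ i, O.valuation (x i) ^ (m i)) → ∃ (R' : Subalgebra k K) (hR'O : R'.toSubring ≤ O.toSubring) (y : Fin n → K) (hy : ∀ i, y i ∈ R'), R ≤ R' ∧ t ∈ R' ∧ R'.FG ∧ ((R' : Set K) ⊆ Subfield.closure ((R : Set K) ∪ {t})) ∧ (∀ i, y i ≠ 0) ∧ Ideal.span (Set.range fun i => (⟨y i, hy i⟩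 : R'.toSubring)) = Ideal.comap (Subring.inclusion hR'O) (IsLocalRing.maximalIdeal O) ∧ (∀ m : Fin n → ℤ, (∏ i, O.valuation (y i) ^ (m i)) = 1 → m = 0))
  (hS5 : ∀ p : ℕ, p.Prime → ∀ (k K : Type) [Field k] [Field K] [Algebra k K] (O : ValuationSubring K) (n : ℕ) (R : Subalgebra k K) (hRO : R.toSubring ≤ O.toSubring) (x : Fin n → K) (hx : ∀ i, x i ∈ R), R.FG → Ideal.span (Set.range fun i => (⟨x i, hx i⟩ : R.toSubring)) = Ideal.comap (Subring.inclusion hRO) (IsLocalRing.maximalIdeal O) → ∀ (t u : K), u ∈ R → O.valuation u = 1 → t ^ p = u → (∀ c : K, c ∈ O → c ∈ Subfield.closure (R : Set K) → O.valuation (u - c ^ p) = 1) → ∃ (R' : Subalgebra k K) (hR'O : R'.toSubring ≤ O.toSubring) (hx' : ∀ i, x i ∈ R'), R ≤ R' ∧ t ∈ R' ∧ R'.FG ∧ ((R' : Set K) ⊆ Subfield.closure ((R : Set K) ∪ {t})) ∧ Ideal.span (Set.range fun i => (⟨x i, hx' i⟩ : R'.toSubring)) = Ideal.comap (Subring.inclusion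 hR'O) (IsLocalRing.maximalIdeal O))

include hS3 hS4 hS5

/-! ### Climbing finitely many `α_p`-steps -/

/-- **Charts climb finitely many `α_p`-steps.** In the setting of the step
(`exists_chart_adjoin_of_pow_mem`): if every `z` of the finite set `T` has `z ^ p ∈ k(s₀)`, a very
good chart of `k(s₀) ⊇ K^{p^e}` yields one of `k(s₀ ∪ T)`. [folklore] -/
theorem exists_chart_adjoin_finset {p : ℕ} (hp : p.Prime) [CharP K p] (O : ValuationSubring K)
    (hk : ∀ c : k, algebraMap k K c ∈ O)
    (hA : IsAbhyankarPlace O (algebraMap k K).fieldRange ⊤)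
    (hr1 : ∀ z w : K, O.valuation z < 1 → w ≠ 0 → ∃ N : ℕ, O.valuation z ^ N < O.valuation w)
    (s : Finset K) (hs : IntermediateField.adjoin k (s : Set K) = ⊤) (e : ℕ)
    (s₀ : Finset K) (hKe : ∀ z : K, z ^ p ^ e ∈ IntermediateField.adjoin k (s₀ : Set K)) {n : ℕ}
    (hchart : ∃ (R : Subalgebra k K) (hRO : R.toSubring ≤ O.toSubring) (x : Fin n → K)
      (hx : ∀ i, x i ∈ R), R.FG ∧ R ≤ (IntermediateField.adjoin k (s₀ : Set K)).toSubalgebra ∧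
      ((IntermediateField.adjoin k (s₀ : Set K) : Set K) ⊆ Subfield.closure (R : Set K)) ∧
      (∀ i, x i ≠ 0) ∧
      Ideal.span (Set.range fun i => (⟨x i, hx i⟩ : R.toSubring)) =
        Ideal.comap (Subring.inclusion hRO) (maximalIdeal O) ∧
      (∀ m : Fin n → ℤ, (∏ i, O.valuation (x i) ^ (m i)) = 1 → m = 0))
    (T : Finset K) (hT : ∀ z ∈ T, z ^ p ∈ IntermediateField.adjoin k (s₀ : Set K)) :
    ∃ (R : Subalgebra k K) (hRO : R.toSubring ≤ O.toSubring) (x : Fin n → K)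
      (hx : ∀ i, x i ∈ R), R.FG ∧ R ≤ (IntermediateField.adjoin k ((s₀ : Set K) ∪ T)).toSubalgebra ∧
      ((IntermediateField.adjoin k ((s₀ : Set K) ∪ T) : Set K) ⊆ Subfield.closure (R : Set K)) ∧
      (∀ i, x i ≠ 0) ∧
      Ideal.span (Set.range fun i => (⟨x i, hx i⟩ : R.toSubring)) =
        Ideal.comap (Subring.inclusion hRO) (maximalIdeal O) ∧
      (∀ m : Fin n → ℤ, (∏ i, O.valuation (x i) ^ (m i)) = 1 → m = 0) := by
  classical
  induction T using Finset.induction_on with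
  | empty =>
    simpa only [Finset.coe_empty, Set.union_empty] using hchart
  | @insert z T hzT ih =>
    have hT' : ∀ z ∈ T, z ^ p ∈ IntermediateField.adjoin k (s₀ : Set K) := fun w hw =>
      hT w (Finset.mem_insert_of_mem hw)
    obtain ⟨R, hRO, x, hx, hfg, hRM, hMR, hx0, hspan, hind⟩ := ih hT'
    set M : IntermediateField k K := IntermediateField.adjoin k ((s₀ : Set K) ∪ T) with hMdef
    have hM' : M = IntermediateField.adjoin k ((s₀ ∪ T : Finset K) : Set K) := by
      rw [hMdef, Finset.coe_union]
    have hle : IntermediateField.adjoin k (s₀ : Set K) ≤ M :=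
      IntermediateField.adjoin.mono k _ _ Set.subset_union_left
    have hMp : ∀ w : K, w ^ p ^ e ∈ M := fun w => hle (hKe w)
    have hzp : z ^ p ∈ M := hle (hT z (Finset.mem_insert_self z T))
    obtain ⟨R', hR'O, x', hx', hfg', hR'M, hMR', hx0', hspan', hind'⟩ :=
      exists_chart_adjoin_of_pow_mem hS3 hS4 hS5 hp O hk hA hr1 s hs M (s₀ ∪ T) hM' e hMp R hRO x
        hx hfg hRM hMR hx0 hspan hind z hzp
    have heq : IntermediateField.adjoin k (insert z (M : Set K)) =
        IntermediateField.adjoin k ((s₀ : Set K) ∪ ↑(insert z T)) := by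
      rw [hMdef, IntermediateField.adjoin_insert_adjoin, Finset.coe_insert, Set.union_insert]
    refine ⟨R', hR'O, x', hx', hfg', ?_, ?_, hx0', hspan', hind'⟩
    · rw [← heq]; exact hR'M
    · rw [← heq]; exact hMR'

/-! ### A very good chart of `K` -/

omit hS3 hS4 hS5 in
/-- `K_e = k(K^{p^e})` as the adjunction of the finite set `s^{p^e}`. [folklore] -/
theorem adjoin_range_pow_eq_adjoin_finset_image {p : ℕ} [Fact p.Prime] [CharP K p] (e : ℕ)
    (s : Finset K) (hs : IntermediateField.adjoin k (s : Set K) = ⊤) [DecidableEq K] :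
    IntermediateField.adjoin k (Set.range fun z : K => z ^ p ^ e) =
      IntermediateField.adjoin k ((s.image fun z : K => z ^ p ^ e : Finset K) : Set K) := by
  rw [adjoin_range_pow_eq_adjoin_image e (s : Set K) hs, Finset.coe_image]

include hS2 in
/-- **A very good chart of `K` itself** (Frobenius twist + tower): for a finitely generated
`K = k(s)` of characteristic `p`, a zero-dimensional rank-one Abhyankar place `O ⊇ k` of `K/k`,
there is a very good chart `(R, x)` of `K` (finitely generated `R ⊆ O` with `K = Frac R`, centre
generated by the non-zero `x₁..xₙ` of `ℤ`-independent values) with `n = trdeg_k K`. [folklore] -/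
theorem exists_chart_top {p : ℕ} (hp : p.Prime) [CharP k p] (O : ValuationSubring K)
    (hk : ∀ c : k, algebraMap k K c ∈ O)
    (hzd : ∀ x : K, x ∈ O → ∃ f : Polynomial k, f ≠ 0 ∧ Polynomial.aeval x f ∈ O.nonunits)
    (hA : IsAbhyankarPlace O (algebraMap k K).fieldRange ⊤)
    (hr1 : ∀ z w : K, O.valuation z < 1 → w ≠ 0 → ∃ N : ℕ, O.valuation z ^ N < O.valuation w)
    (s : Finset K) (hs : IntermediateField.adjoin k (s : Set K) = ⊤) :
    ∃ (n : ℕ) (R : Subalgebra k K) (hRO : R.toSubring ≤ O.toSubring) (x : Fin n → K)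
      (hx : ∀ i, x i ∈ R), R.FG ∧ (∀ z : K, z ∈ Subfield.closure (R : Set K)) ∧
      (∀ i, x i ≠ 0) ∧
      Ideal.span (Set.range fun i => (⟨x i, hx i⟩ : R.toSubring)) =
        Ideal.comap (Subring.inclusion hRO) (maximalIdeal O) ∧
      (∀ m : Fin n → ℤ, (∏ i, O.valuation (x i) ^ (m i)) = 1 → m = 0) ∧
      Algebra.trdeg k K = n := by
  classical
  haveI : Fact p.Prime := ⟨hp⟩
  haveI : CharP K p := charP_of_injective_algebraMap (algebraMap k K).injective p
  have htopfg : (⊤ : IntermediateField k K).FG := ⟨s, hs⟩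
  -- S1: the Frobenius twist
  obtain ⟨e, hsep⟩ := stub_frobeniusTwistSeparable p hp k K O hk htopfg hA
  set Ke : IntermediateField k K := IntermediateField.adjoin k (Set.range fun z : K => z ^ p ^ e)
    with hKe
  set T₀ : Finset K := s.image fun z : K => z ^ p ^ e with hT₀
  have hKeT₀ : Ke = IntermediateField.adjoin k (T₀ : Set K) :=
    adjoin_range_pow_eq_adjoin_finset_image e s hs
  have hKefg : Ke.FG := ⟨T₀, hKeT₀.symm⟩
  have hKalg : ∀ z : K, IsAlgebraic Ke z := fun z => isAlgebraic_adjoin_range_pow hp.pos e z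
  -- S2: the base chart of `K_e`
  obtain ⟨n, R₀, hR₀O, x₀, hx₀, hfg₀, hR₀M, hMR₀, hx₀0, hspan₀, hind₀, hbasis⟩ :=
    hS2 p hp k K O hk htopfg hzd Ke hKefg (isAbhyankarPlace_adjoin_range_pow hp.pos e O hA) hsep
      hKalg
  have htr : Algebra.trdeg k K = n := by
    have h := hbasis.lift_cardinalMk_eq_trdeg
    simp only [Cardinal.mk_fintype, Fintype.card_fin, Cardinal.lift_id] at h
    exact h.symm
  -- the tower: by induction on `d ≤ e`, a chart of `k(T_d)` with `s^{p^{e-d}} ⊆ T_d`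
  have htower : ∀ d : ℕ, d ≤ e → ∃ (T : Finset K),
      (s.image fun z : K => z ^ p ^ (e - d)) ⊆ T ∧
      (∀ z : K, z ^ p ^ e ∈ IntermediateField.adjoin k (T : Set K)) ∧
      ∃ (R : Subalgebra k K) (hRO : R.toSubring ≤ O.toSubring) (x : Fin n → K)
        (hx : ∀ i, x i ∈ R), R.FG ∧ R ≤ (IntermediateField.adjoin k (T : Set K)).toSubalgebra ∧
        ((IntermediateField.adjoin k (T : Set K) : Set K) ⊆ Subfield.closure (R : Set K)) ∧
        (∀ i, x i ≠ 0) ∧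
        Ideal.span (Set.range fun i => (⟨x i, hx i⟩ : R.toSubring)) =
          Ideal.comap (Subring.inclusion hRO) (maximalIdeal O) ∧
        (∀ m : Fin n → ℤ, (∏ i, O.valuation (x i) ^ (m i)) = 1 → m = 0) := by
    intro d
    induction d with
    | zero =>
      intro _
      refine ⟨T₀, by rw [Nat.sub_zero], fun z => ?_, R₀, hR₀O, x₀, hx₀, hfg₀, ?_, ?_, hx₀0,
        hspan₀, hind₀⟩
      · rw [← hKeT₀]; exact pow_mem_adjoin_range_pow p e z
      · rw [← hKeT₀]; exact hR₀M
      · rw [← hKeT₀]; exact hMR₀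
    | succ d ih =>
      intro hd
      obtain ⟨T, hsT, hKeT, hchart⟩ := ih (Nat.le_of_succ_le hd)
      set T' : Finset K := s.image fun z : K => z ^ p ^ (e - (d + 1)) with hT'
      have hT'p : ∀ z ∈ T', z ^ p ∈ IntermediateField.adjoin k (T : Set K) := by
        intro w hw
        obtain ⟨z, hz, rfl⟩ := Finset.mem_image.mp hw
        have hpow : (z ^ p ^ (e - (d + 1))) ^ p = z ^ p ^ (e - d) := by
          rw [← pow_mul, ← pow_succ]
          congr 2
          omega
        rw [hpow]
        exact IntermediateField.subset_adjoin k _ (hsT (Finset.mem_image.mpr ⟨z, hz, rfl⟩))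
      obtain ⟨R, hRO, x, hx, hfg, hRM, hMR, hx0, hspan, hind⟩ :=
        exists_chart_adjoin_finset hS3 hS4 hS5 hp O hk hA hr1 s hs e T hKeT hchart T' hT'p
      refine ⟨T ∪ T', ?_, fun z => ?_, R, hRO, x, hx, hfg, ?_, ?_, hx0, hspan, hind⟩
      · exact Finset.subset_union_right
      · exact IntermediateField.adjoin.mono k _ _ (by rw [Finset.coe_union]; exact Set.subset_union_left)
          (hKeT z)
      · rw [Finset.coe_union]; exact hRM
      · rw [Finset.coe_union]; exact hMR
  obtain ⟨T, hsT, -, R, hRO, x, hx, hfg, hRM, hMR, hx0, hspan, hind⟩ := htower e le_rfl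
  have htop : IntermediateField.adjoin k (T : Set K) = ⊤ := by
    rw [eq_top_iff, ← hs]
    refine IntermediateField.adjoin.mono k _ _ fun z hz => ?_
    have h := hsT (Finset.mem_image.mpr ⟨z, hz, by rw [Nat.sub_self, pow_zero, pow_one]⟩)
    exact h
  refine ⟨n, R, hRO, x, hx, hfg, fun z => hMR ?_, hx0, hspan, hind, htr⟩
  rw [htop]
  trivial

end Stubs

/-- **`K` is algebraic over `K_e = k(K^{p^e})`** (registered sub-goal form of
`isAlgebraic_adjoin_range_pow`, binders explicit). [folklore] -/
theorem isAlgebraic_frobTwist :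
    ∀ (k K : Type) [Field k] [Field K] [Algebra k K] (p : ℕ), 0 < p → ∀ (e : ℕ) (z : K), IsAlgebraic (IntermediateField.adjoin k (Set.range fun z : K => z ^ p ^ e)) z := by
  intro k K _ _ _ p hp e z
  exact isAlgebraic_adjoin_range_pow hp e z

end Summit.ResolutionOfSingularities.ResolutionOfSingularities.Theorems.PfaffLine
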